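import Mathlib
import HarnessLib
import Summits.ValiantsHypothesis.ValiantsHypothesis.Theses.MonotoneRestoration
import Summits.ValiantsHypothesis.ValiantsHypothesis.Theorems.MonotoneRestorationOrbitRestorationQPDepthThreeRungDefs
import Summits.ValiantsHypothesis.ValiantsHypothesis.Theorems.MonotoneRestorationOrbitRestorationQPVsbr

/-!
# Line `depth_three_rung` of crux `OrbitRestorationQP` (stmt-ValiantsHypothesis-18293): the limit stub IS the crux

The registered skeleton (`Cruxes/OrbitRestorationQP/Lines/depth_three_rung.lean`, 5d811172bf6d5dd8) has two open stubs,
`stub_sigmaPiSigmaValue` (A_∞, the `ΣΠΣ` rung in value currency) and `stub_logDepthRestoration` (the ladder's LIMIT: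
restoration on the product-depth-`c₀ (log₂ n + 1)` slices of `VP`, for every `c₀`).  The skeleton's own docstring says the
limit stub is "`X`-equivalent given VSBR — NOT a prover target"; the two directions live there only as Cruxes-side lemmas.
This file makes that statement a kernel-checked THEOREM of the tree, over the Theorems-side copy of the line's vocabulary
(`…DepthThreeRungDefs.lean`: `IsMatrixSymmetric`, `PDClass`, `VPClass`, `QPOrbitRestorable`, `RestorationOn`,
`ProductDepthRestorationQP`) and the LANDED stub `stub_vsbr` (p581292, VSBR on the slices):

* `orbitRestorationQP_of_logDepthRestoration` — the registered signature of `stub_logDepthRestoration`, VERBATIM, implies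
  `Theses.MonotoneRestoration.OrbitRestorationQP` (through `stub_vsbr`);
* `logDepthRestoration_of_orbitRestorationQP` — the crux implies the registered signature (every product-depth slice is a
  slice of `VP`: `productDepthRestorationQP_of_orbitRestorationQP`, ON-PATH for every rung, in particular for A_∞:
  `sigmaPiSigmaValue_of_orbitRestorationQP` is the registered signature of `stub_sigmaPiSigmaValue` from the crux);
* `logDepthRestoration_iff_orbitRestorationQP` — the `↔`.

Census consequence (by name, kernel): of the two open stubs of the registered line, `stub_logDepthRestoration` is
LITERALLY crux-equivalent (closing it closes stmt-18293 and, through the route's `closes`, the summit), so the line's only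
sub-crux content is `stub_sigmaPiSigmaValue`.  Honest label: bookkeeping over landed theorems; no stub is closed;
VP ≠ VNP is not touched.
-/

noncomputable section

-- the summit and the problem share the name `ValiantsHypothesis` (D-0017 single-conjunct layout)
set_option linter.dupNamespace false

namespace Summit.ValiantsHypothesis.ValiantsHypothesis.Theorems.OrbitRestorationQPDepthThreeRung

open Summit.ValiantsHypothesis.ValiantsHypothesis.Theses.MonotoneRestoration
open Literature.Computability.AlgebraicComplexity

/-- `PDClass δ ⊆ VPClass` (definitional: the `VP` envelope is carried explicitly). [folklore] -/
theorem logDepth_vpClass_of_pdClass {δ : ℕ → ℕ} {n c : ℕ} {q : MvPolynomial (Fin n × Fin n) ℂ}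
    (h : PDClass δ n c q) : VPClass n c q := ⟨h.1, h.2.1⟩

/-- A family in the slices `VPClass n c` (one `c`, all `n`) is a `VP` family in the tree's sense (`IsVPFamily`:
`n²` variables, degree and complexity p-bounded). [cite: Burgisser2000, Def. 2.4] -/
theorem logDepth_isVPFamily_of_vpClass {f : (n : ℕ) → MvPolynomial (Fin n × Fin n) ℂ}
    (h : ∃ c : ℕ, ∀ n : ℕ, VPClass n c (f n)) : IsVPFamily f := by
  obtain ⟨c, hc⟩ := h
  refine ⟨⟨⟨2, fun n => ?_⟩, ⟨c, fun n => (hc n).1⟩⟩, ⟨c, fun n => (hc n).2⟩⟩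
  simp only [Fintype.card_prod, Fintype.card_fin]
  nlinarith

/-- A `VP` family lies in the slices `VPClass n c` for ONE constant `c` (merge the degree and the complexity
exponents with `vsbr_pbound_mono`). [cite: Burgisser2000, Def. 2.4] -/
theorem logDepth_vpClass_of_isVPFamily {f : (n : ℕ) → MvPolynomial (Fin n × Fin n) ℂ} (h : IsVPFamily f) :
    ∃ c : ℕ, ∀ n : ℕ, VPClass n c (f n) := by
  obtain ⟨⟨-, c₁, h₁⟩, c₂, h₂⟩ := h
  refine ⟨c₁ + c₂, fun n => ⟨(h₁ n).trans (vsbr_pbound_mono (by omega) n), ?_⟩⟩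
  exact (h₂ n).trans (vsbr_pbound_mono (by omega) n)

/-- The crux is the top slice of the graded family: `OrbitRestorationQP ↔ RestorationOn VPClass`. [folklore] -/
theorem orbitRestorationQP_iff_restorationOnVP : OrbitRestorationQP ↔ RestorationOn VPClass := by
  constructor
  · intro hX f hsym hcls
    exact hX f hsym (logDepth_isVPFamily_of_vpClass hcls)
  · intro hR f hsym hVP
    exact hR f hsym (logDepth_vpClass_of_isVPFamily hVP)

/-- **ON-PATH for every rung of the product-depth ladder:** the crux implies `ProductDepthRestorationQP δ` for every
depth budget `δ` (a product-depth slice is a slice of `VP`). [folklore] -/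
theorem productDepthRestorationQP_of_orbitRestorationQP (δ : ℕ → ℕ) (hX : OrbitRestorationQP) :
    ProductDepthRestorationQP δ := by
  intro f hsym hcls
  obtain ⟨c, hc⟩ := hcls
  exact orbitRestorationQP_iff_restorationOnVP.1 hX f hsym ⟨c, fun n => logDepth_vpClass_of_pdClass (hc n)⟩

/-- **ON-PATH for A_∞:** the crux implies the registered signature of `stub_sigmaPiSigmaValue` (the `ΣΠΣ` rung in value
currency), verbatim. [folklore] -/
theorem sigmaPiSigmaValue_of_orbitRestorationQP (hX : OrbitRestorationQP) :
    ∀ f : (n : ℕ) → MvPolynomial (Fin n × Fin n) ℂ, IsMatrixSymmetric f →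
      (∃ c : ℕ, ∀ n : ℕ, PDClass (fun _ => 1) n c (f n)) →
      ∃ c : ℕ, ∀ n : ℕ, QPOrbitRestorable c n (f n) :=
  productDepthRestorationQP_of_orbitRestorationQP (fun _ => 1) hX

/-- **The crux implies the limit stub:** `OrbitRestorationQP` gives the registered signature of
`stub_logDepthRestoration`, verbatim (every `c₀ (log₂ n + 1)` slice is a slice of `VP`). [folklore] -/
theorem logDepthRestoration_of_orbitRestorationQP (hX : OrbitRestorationQP) :
    ∀ c₀ : ℕ, ∀ f : (n : ℕ) → MvPolynomial (Fin n × Fin n) ℂ, IsMatrixSymmetric f →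
      (∃ c : ℕ, ∀ n : ℕ, PDClass (fun n => c₀ * (Nat.log 2 n + 1)) n c (f n)) →
      ∃ c : ℕ, ∀ n : ℕ, QPOrbitRestorable c n (f n) :=
  fun c₀ => productDepthRestorationQP_of_orbitRestorationQP (fun n => c₀ * (Nat.log 2 n + 1)) hX

/-- **The limit stub implies the crux:** the registered signature of `stub_logDepthRestoration`, verbatim, gives
`OrbitRestorationQP` — a matrix-symmetric `VP` family lies in one slice `VPClass · c`, hence (LANDED `stub_vsbr`,
Valiant–Skyum–Berkowitz–Rackoff on the slices) in one product-depth-`c₀ (log₂ n + 1)` slice, where the stub restores it.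
[cite: ValiantSkyumBerkowitzRackoff1983] -/
theorem orbitRestorationQP_of_logDepthRestoration
    (hL : ∀ c₀ : ℕ, ∀ f : (n : ℕ) → MvPolynomial (Fin n × Fin n) ℂ, IsMatrixSymmetric f →
      (∃ c : ℕ, ∀ n : ℕ, PDClass (fun n => c₀ * (Nat.log 2 n + 1)) n c (f n)) →
      ∃ c : ℕ, ∀ n : ℕ, QPOrbitRestorable c n (f n)) :
    OrbitRestorationQP := by
  refine orbitRestorationQP_iff_restorationOnVP.2 fun f hsym hcls => ?_
  obtain ⟨c₀, c', h⟩ := stub_vsbr f hcls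
  exact hL c₀ f hsym ⟨c', h⟩

/-- **`stub_logDepthRestoration` ⟺ the crux.**  The registered signature of the limit stub of line `depth_three_rung`
(verbatim) is equivalent to `Theses.MonotoneRestoration.OrbitRestorationQP` (stmt-ValiantsHypothesis-18293).
[cite: ValiantSkyumBerkowitzRackoff1983] -/
theorem logDepthRestoration_iff_orbitRestorationQP :
    (∀ c₀ : ℕ, ∀ f : (n : ℕ) → MvPolynomial (Fin n × Fin n) ℂ, IsMatrixSymmetric f →
      (∃ c : ℕ, ∀ n : ℕ, PDClass (fun n => c₀ * (Nat.log 2 n + 1)) n c (f n)) →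
      ∃ c : ℕ, ∀ n : ℕ, QPOrbitRestorable c n (f n)) ↔
    OrbitRestorationQP :=
  ⟨orbitRestorationQP_of_logDepthRestoration, logDepthRestoration_of_orbitRestorationQP⟩

/-- The same, bundled through the ladder vocabulary: the crux is equivalent to "every product-depth rung holds"
(`∀ δ, ProductDepthRestorationQP δ`), and to the single family of rungs `δ n = c₀ (log₂ n + 1)`. [folklore] -/
theorem orbitRestorationQP_iff_all_productDepth_rungs :
    OrbitRestorationQP ↔ ∀ δ : ℕ → ℕ, ProductDepthRestorationQP δ :=
  ⟨fun hX δ => productDepthRestorationQP_of_orbitRestorationQP δ hX,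
    fun h => orbitRestorationQP_of_logDepthRestoration fun c₀ => h fun n => c₀ * (Nat.log 2 n + 1)⟩

end Summit.ValiantsHypothesis.ValiantsHypothesis.Theorems.OrbitRestorationQPDepthThreeRung

end
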